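import Literature.Analysis.FluidPDE.PlanarCircleWirtinger
import HarnessLib

/-!
# A generalized Wirtinger inequality (Croce–Dacorogna 2003, Theorem 1.1 at `p = q = 2`) — proved

search for candidate a priori estimates; no regularity claim.

Analysis/FluidPDE file. EXPORTS ONLY THE PRINTED, CITED STATEMENTS (cell rule: `Literature/` exports
published results; everything else in this file is a `private` proof device):

* `CroceDacorognaWirtinger` — the printed statement at `p = q = 2`, typed (a named `Prop`, because
  downstream files take exactly this text as a hypothesis);
* `CroceDacorognaWirtinger_holds` — its PROOF;
* `croceDacorognaWirtinger_interval` — the printed rescaled form on `(a, b)` (Rem. 1.2 (i)),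
  `2 ≤ r ≤ 3`;
* `croceDacorognaWirtinger_two` — the `r = 2` slice via the tree's classical Wirtinger inequality.

**The printed result.** Croce–Dacorogna, *On a generalized Wirtinger inequality*, Discrete
Contin. Dyn. Syst. 9 (2003) 1329–1341, Theorem 1.1: for `p > 1`, `q ≥ r − 1 ≥ 1`,
`α(p,q,r) := inf {‖u′‖_p/‖u‖_q : u ∈ W^{1,p}_per(−1,1) ∖ {0}, ∫_{−1}^{1}|u|^{r−2}u = 0}` equals
`α(p,q,q)` whenever `q ≤ rp + r − 1`; Remark 1.2 (ii): `α(2,2,2) = π`; Remark 1.2 (i): on `(a, b)`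
the constant is multiplied by `(2/(b−a))^{1/p′+1/q}`. At `p = q = 2` the hypotheses read
`2 ≤ r ≤ 3`, so: for `u ∈ W^{1,2}_per(−1,1)` with `∫_{−1}^{1}|u|^{r−2}u = 0`,
`π² ∫_{−1}^{1} u² ≤ ∫_{−1}^{1} u′²` (typed for `C¹` functions with `u(−1) = u(1)`, a sub-class of
the printed class).

**About the proof (private).** The published proof is variational (existence of minimizers and
an analysis of the Euler–Lagrange equation, §2 of the paper) and is not formalised. The proof
below is an elementary half-shift argument; its natural generality (any odd, strictly increasing,
continuous constraint function `φ` in place of `|t|^{r−2}t`, hence every exponent `r > 1`) is the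
PROOF'S, not the paper's, and is therefore not exported from this Literature file:

* (private) `exists_antipodal_zero_of_integral_comp_eq_zero`: `∫_{−1}^{1} φ(u) = 0` forces
  `u(y₀) + u(y₀+1) = 0` for some `y₀ ∈ [−1,0]` (otherwise `u + u(·+1)` has a sign on `[−1,0]`,
  hence so has `φ(u) + φ(u(·+1))`, whose integral over `[−1,0]` is `∫_{−1}^{1} φ(u) = 0`);
* (private) `wirtinger_of_antipodal_zero`: an antipodal zero gives `π² ∫u² ≤ ∫u′²`, by the
  decomposition `u = E + M`, `u(·+1) = E − M` on `[−1,0]` (`E` has equal end values and a zero,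
  `M` opposite end values) and two period-`1` inequalities with constant `π²`
  (`periodic_wirtinger_of_zero`, `antiperiodic_wirtinger`), both instances of ONE engine,
  `antiperiodic_wirtinger_two_piece`: for two `C¹` pieces glued continuously at an interior
  point, with opposite values at the ends of `[a,b]`, `(π/(b−a))² ∫ G² ≤ ∫ G′²` — Parseval
  (`hasSum_sq_fourierCoeffOn`, as in the tree's `wirtinger_interval`) for the glued function
  twisted by `exp(−iπx/(b−a))`, whose Fourier modes are the half-integer modes `π(2n+1)/(b−a)`
  of the glued function (one integration by parts per piece; the boundary terms cancel by the
  gluing and the antiperiodicity).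

## References

* G. Croce, B. Dacorogna, *On a generalized Wirtinger inequality*, Discrete Contin. Dyn. Syst.
  9 (2003), no. 5, 1329–1341, Thm. 1.1, Rem. 1.2. [CroceDacorogna2003]
* G. H. Hardy, J. E. Littlewood, G. Pólya, *Inequalities*, CUP 1952, §7.7 (Wirtinger).
-/

noncomputable section

open Set Function Filter MeasureTheory Real
open scoped Topology

namespace Literature.Analysis.FluidPDE

/-- A bounded a.e.-strongly measurable function is square integrable on `(a, b]`. (Private proof
device of `CroceDacorognaWirtinger_holds`; not itself a printed statement.) [folklore] -/
private theorem memLp_two_Ioc_of_bound {f : ℝ → ℂ} {a b : ℝ}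
    (hf : AEStronglyMeasurable f (volume.restrict (Ioc a b))) (C : ℝ)
    (hC : ∀ x ∈ Ioc a b, ‖f x‖ ≤ C) : MemLp f 2 (volume.restrict (Ioc a b)) := by
  have htop : MemLp f ⊤ (volume.restrict (Ioc a b)) := by
    refine memLp_top_of_bound hf C ?_
    rw [ae_restrict_iff' measurableSet_Ioc]
    exact Eventually.of_forall hC
  exact htop.mono_exponent le_top

/-- A bounded a.e.-strongly measurable function is interval integrable on `[a, b]`. (Private proof
device of `CroceDacorognaWirtinger_holds`; not itself a printed statement.) [folklore] -/
private theorem intervalIntegrable_Ioc_of_bound {E : Type*} [NormedAddCommGroup E] {f : ℝ → E}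
    {a b : ℝ}
    (hab : a ≤ b) (hf : AEStronglyMeasurable f (volume.restrict (Ioc a b))) (C : ℝ)
    (hC : ∀ x ∈ Ioc a b, ‖f x‖ ≤ C) : IntervalIntegrable f volume a b := by
  rw [intervalIntegrable_iff_integrableOn_Ioc_of_le hab]
  have htop : MemLp f ⊤ (volume.restrict (Ioc a b)) := by
    refine memLp_top_of_bound hf C ?_
    rw [ae_restrict_iff' measurableSet_Ioc]
    exact Eventually.of_forall hC
  exact htop.integrable le_top

/-- `exp(−iπ(2n+1)) = −1`. (Private proof device of `CroceDacorognaWirtinger_holds`; not itself a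
printed statement.) [folklore] -/
private theorem cexp_neg_pi_mul_two_mul_add_one_mul_I (n : ℤ) :
    Complex.exp (-(π * (2 * n + 1) : ℂ) * Complex.I) = -1 := by
  have h1 : -(π * (2 * n + 1) : ℂ) * Complex.I =
      ((-(n + 1) : ℤ) : ℂ) * (2 * π * Complex.I) + π * Complex.I := by
    push_cast; ring
  rw [h1, Complex.exp_add, Complex.exp_int_mul_two_pi_mul_I, Complex.exp_pi_mul_I]; ring

/-- The half-integer phase `exp(−iπ(2n+1)x/T)` is `fourier (−n) x · exp(−iπx/T)` on `AddCircle T`.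
(Private proof device of `CroceDacorognaWirtinger_holds`; not itself a printed statement.)
[folklore] -/
private theorem fourier_neg_mul_cexp_half {T : ℝ} (n : ℤ) (x : ℝ) :
    fourier (-n) (x : AddCircle T) * Complex.exp (((-(π * x / T) : ℝ) : ℂ) * Complex.I) =
      Complex.exp (((-(π * (2 * n + 1) / T * x) : ℝ) : ℂ) * Complex.I) := by
  rw [fourier_coe_apply, ← Complex.exp_add]
  congr 1
  push_cast
  ring

/-- Derivative of the phase `x ↦ exp(−iκx)`. (Private proof device of
`CroceDacorognaWirtinger_holds`; not itself a printed statement.) [folklore] -/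
private theorem hasDerivAt_cexp_half (κ x : ℝ) :
    HasDerivAt (fun y : ℝ => Complex.exp (((-(κ * y) : ℝ) : ℂ) * Complex.I))
      (Complex.exp (((-(κ * x) : ℝ) : ℂ) * Complex.I) * (((-κ : ℝ) : ℂ) * Complex.I)) x := by
  have h1 : HasDerivAt (fun y : ℝ => -(κ * y)) (-κ) x := by
    have h := (hasDerivAt_id x).const_mul (-κ)
    simpa [neg_mul] using h
  have h2 : HasDerivAt (fun y : ℝ => (((-(κ * y)) : ℝ) : ℂ) * Complex.I)
      ((((-κ : ℝ)) : ℂ) * Complex.I) x := h1.ofReal_comp.mul_const Complex.I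
  exact h2.cexp

/-- **Two-piece antiperiodic Wirtinger inequality** (the engine). For `a < c < b`, `T = b − a`, `C¹`
functions `M₁` (used on `[a, c]`) and `M₂` (used on `[c, b]`) that glue continuously at `c` (`M₁ c =
M₂ c`) and are *antiperiodic* across the ends (`M₂ b = −M₁ a`): `(π/T)² (∫_a^c M₁² + ∫_c^b M₂²) ≤
∫_a^c M₁′² + ∫_c^b M₂′²`. Proof: the glued function times `exp(−iπx/T)` is continuous with equal
values at `a` and `b`; its Fourier modes on `[a, b]` are the half-integer modes `π(2n+1)/T` of the
glued function, all of modulus `≥ π/T` (one integration by parts per piece; the boundary terms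
cancel by the gluing and the antiperiodicity); Parseval (`hasSum_sq_fourierCoeffOn`) for the
function and for its piecewise derivative. (Private proof engine of `CroceDacorognaWirtinger_holds`:
a classical Wirtinger-type inequality, kept private because this file exports only the cited printed
statements.) [folklore] -/
private theorem antiperiodic_wirtinger_two_piece {M₁ M₁' M₂ M₂' : ℝ → ℝ} {a c b : ℝ} (hac : a < c)
    (hcb : c < b) (h1 : ∀ x, HasDerivAt M₁ (M₁' x) x) (h1c : Continuous M₁')
    (h2 : ∀ x, HasDerivAt M₂ (M₂' x) x) (h2c : Continuous M₂') (hglue : M₁ c = M₂ c)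
    (hanti : M₂ b = -M₁ a) :
    (π / (b - a)) ^ 2 * ((∫ x in a..c, M₁ x ^ 2) + ∫ x in c..b, M₂ x ^ 2) ≤
      (∫ x in a..c, M₁' x ^ 2) + ∫ x in c..b, M₂' x ^ 2 := by
  have hab : a < b := hac.trans hcb
  have hT : 0 < b - a := sub_pos.2 hab
  have hM₁c : Continuous M₁ := continuous_iff_continuousAt.mpr fun x => (h1 x).continuousAt
  have hM₂c : Continuous M₂ := continuous_iff_continuousAt.mpr fun x => (h2 x).continuousAt
  have hsub1 : uIcc a c ⊆ uIcc a b := by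
    rw [uIcc_of_le hac.le, uIcc_of_le hab.le]; exact Icc_subset_Icc_right hcb.le
  have hsub2 : uIcc c b ⊆ uIcc a b := by
    rw [uIcc_of_le hcb.le, uIcc_of_le hab.le]; exact Icc_subset_Icc_left hac.le
  -- the glued function and its (piecewise) derivative
  obtain ⟨G, hG⟩ : ∃ G : ℝ → ℝ, G = fun x => if x ≤ c then M₁ x else M₂ x := ⟨_, rfl⟩
  obtain ⟨G', hG'⟩ : ∃ G' : ℝ → ℝ, G' = fun x => if x ≤ c then M₁' x else M₂' x := ⟨_, rfl⟩
  have hGc : Continuous G := by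
    rw [hG]
    exact continuous_if_le continuous_id continuous_const hM₁c.continuousOn hM₂c.continuousOn
      (fun x hx => by rw [hx, hglue])
  have hG'm : Measurable G' := by
    rw [hG']
    exact Measurable.ite measurableSet_Iic h1c.measurable h2c.measurable
  have hG1 : ∀ x ∈ uIcc a c, G x = M₁ x := fun x hx => by
    rw [uIcc_of_le hac.le] at hx; simp only [hG, if_pos hx.2]
  have hG2 : ∀ x ∈ uIcc c b, G x = M₂ x := fun x hx => by
    rw [uIcc_of_le hcb.le] at hx
    by_cases h : x ≤ c
    · have : x = c := le_antisymm h hx.1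
      rw [this, hG]; dsimp only; rw [if_pos le_rfl, hglue]
    · simp only [hG, if_neg h]
  have hG'1 : ∀ x ∈ uIcc a c, G' x = M₁' x := fun x hx => by
    rw [uIcc_of_le hac.le] at hx; simp only [hG', if_pos hx.2]
  have hG'2 : ∀ x ∈ uIoc c b, G' x = M₂' x := fun x hx => by
    rw [uIoc_of_le hcb.le] at hx; simp only [hG', if_neg (not_le.2 hx.1)]
  -- a bound for `G'` on `(a, b]`
  obtain ⟨C₁, hC₁⟩ := (isCompact_Icc (a := a) (b := b)).exists_bound_of_continuousOn
    h1c.continuousOn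
  obtain ⟨C₂, hC₂⟩ := (isCompact_Icc (a := a) (b := b)).exists_bound_of_continuousOn
    h2c.continuousOn
  have hG'b : ∀ x ∈ Ioc a b, ‖G' x‖ ≤ max C₁ C₂ := fun x hx => by
    rw [hG']; dsimp only
    split_ifs
    · exact (hC₁ x (Ioc_subset_Icc_self hx)).trans (le_max_left _ _)
    · exact (hC₂ x (Ioc_subset_Icc_self hx)).trans (le_max_right _ _)
  -- the twist and the twisted functions
  obtain ⟨τ, hτ⟩ : ∃ τ : ℝ → ℂ,
      τ = fun x => Complex.exp (((-(π * x / (b - a)) : ℝ) : ℂ) * Complex.I) := ⟨_, rfl⟩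
  have hτn : ∀ x, ‖τ x‖ = 1 := fun x => by rw [hτ]; exact Complex.norm_exp_ofReal_mul_I _
  have hτc : Continuous τ := by rw [hτ]; fun_prop
  obtain ⟨P, hP⟩ : ∃ P : ℝ → ℂ, P = fun x => (G x : ℂ) * τ x := ⟨_, rfl⟩
  obtain ⟨Q, hQ⟩ : ∃ Q : ℝ → ℂ, Q = fun x => (G' x : ℂ) * τ x := ⟨_, rfl⟩
  have hPc : Continuous P := by rw [hP]; exact (Complex.continuous_ofReal.comp hGc).mul hτc
  have hPn : ∀ x, ‖P x‖ ^ 2 = G x ^ 2 := fun x => by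
    rw [hP]; dsimp only
    rw [norm_mul, hτn, mul_one, Complex.norm_real, Real.norm_eq_abs, sq_abs]
  have hQn : ∀ x, ‖Q x‖ ^ 2 = G' x ^ 2 := fun x => by
    rw [hQ]; dsimp only
    rw [norm_mul, hτn, mul_one, Complex.norm_real, Real.norm_eq_abs, sq_abs]
  have hQm : AEStronglyMeasurable Q (volume.restrict (Ioc a b)) := by
    rw [hQ]
    exact ((Complex.measurable_ofReal.comp hG'm).mul hτc.measurable).aestronglyMeasurable
  have hQb : ∀ x ∈ Ioc a b, ‖Q x‖ ≤ max C₁ C₂ := fun x hx => by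
    have : ‖Q x‖ = ‖G' x‖ := by
      rw [hQ]; dsimp only; rw [norm_mul, hτn, mul_one, Complex.norm_real]
    rw [this]; exact hG'b x hx
  -- square integrability and Parseval
  have hPL : MemLp P 2 (volume.restrict (Ioc a b)) := memLp_two_Ioc_of_continuous' hPc a b
  have hQL : MemLp Q 2 (volume.restrict (Ioc a b)) := memLp_two_Ioc_of_bound hQm _ hQb
  have PP := hasSum_sq_fourierCoeffOn hab hPL
  have PQ := hasSum_sq_fourierCoeffOn hab hQL
  simp only [smul_eq_mul] at PP PQ
  have hQi : IntervalIntegrable Q volume a b := intervalIntegrable_Ioc_of_bound hab.le hQm _ hQb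
  -- the key identity: `c_n(Q) = i κ_n c_n(P)`, `κ_n = π(2n+1)/T`
  have key : ∀ n : ℤ, fourierCoeffOn hab Q n =
      ((((π * (2 * n + 1) / (b - a)) : ℝ) : ℂ) * Complex.I) * fourierCoeffOn hab P n := by
    intro n
    set κ : ℝ := π * (2 * n + 1) / (b - a) with hκ
    obtain ⟨e, he⟩ : ∃ e : ℝ → ℂ,
        e = fun x => Complex.exp (((-(κ * x) : ℝ) : ℂ) * Complex.I) := ⟨_, rfl⟩
    have hed : ∀ x, HasDerivAt e (e x * ((((-κ : ℝ)) : ℂ) * Complex.I)) x := by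
      intro x; rw [he]; exact hasDerivAt_cexp_half κ x
    have hec : Continuous e := by rw [he]; fun_prop
    have he'c : Continuous fun x => e x * ((((-κ : ℝ)) : ℂ) * Complex.I) :=
      hec.mul continuous_const
    have hfe : ∀ x : ℝ, fourier (-n) (x : AddCircle (b - a)) * τ x = e x := by
      intro x; rw [hτ, he]; dsimp only
      rw [fourier_neg_mul_cexp_half]
    -- `e(b) = -e(a)`
    have heb : e b = -e a := by
      rw [he]; dsimp only
      have : (((-(κ * b)) : ℝ) : ℂ) * Complex.I =
          (((-(κ * a)) : ℝ) : ℂ) * Complex.I + (-(π * (2 * n + 1) : ℂ) * Complex.I) := by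
        have hb : κ * b = κ * a + π * (2 * n + 1) := by
          have hκT : κ * (b - a) = π * (2 * n + 1) := by rw [hκ]; field_simp
          linear_combination hκT
        rw [hb]; push_cast; ring
      rw [this, Complex.exp_add, cexp_neg_pi_mul_two_mul_add_one_mul_I]; ring
    -- the coefficients as phase integrals
    have hcQ : fourierCoeffOn hab Q n = (1 / (b - a) : ℝ) • ∫ x in a..b, e x * (G' x : ℂ) := by
      rw [fourierCoeffOn_eq_integral Q n hab]
      congr 1
      apply intervalIntegral.integral_congr
      intro x _
      rw [hQ]; dsimp only; rw [smul_eq_mul, ← hfe x]; ring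
    have hcP : fourierCoeffOn hab P n = (1 / (b - a) : ℝ) • ∫ x in a..b, e x * (G x : ℂ) := by
      rw [fourierCoeffOn_eq_integral P n hab]
      congr 1
      apply intervalIntegral.integral_congr
      intro x _
      rw [hP]; dsimp only; rw [smul_eq_mul, ← hfe x]; ring
    -- integrability of the phase integrands
    have hiQ : IntervalIntegrable (fun x => e x * (G' x : ℂ)) volume a b := by
      refine intervalIntegrable_Ioc_of_bound hab.le ?_ (max C₁ C₂) fun x hx => ?_
      · exact (hec.measurable.mul (Complex.measurable_ofReal.comp hG'm)).aestronglyMeasurable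
      · rw [norm_mul, he]; dsimp only
        rw [Complex.norm_exp_ofReal_mul_I, one_mul, Complex.norm_real]; exact hG'b x hx
    have hiP : IntervalIntegrable (fun x => e x * (G x : ℂ)) volume a b :=
      (hec.mul (Complex.continuous_ofReal.comp hGc)).intervalIntegrable _ _
    -- integration by parts on each piece
    have ibp1 := intervalIntegral.integral_mul_deriv_eq_deriv_mul (a := a) (b := c)
      (u := e) (v := fun x => (M₁ x : ℂ)) (u' := fun x => e x * ((((-κ : ℝ)) : ℂ) * Complex.I))
      (v' := fun x => (M₁' x : ℂ)) (fun x _ => hed x) (fun x _ => (h1 x).ofReal_comp)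
      (he'c.intervalIntegrable _ _) ((Complex.continuous_ofReal.comp h1c).intervalIntegrable _ _)
    have ibp2 := intervalIntegral.integral_mul_deriv_eq_deriv_mul (a := c) (b := b)
      (u := e) (v := fun x => (M₂ x : ℂ)) (u' := fun x => e x * ((((-κ : ℝ)) : ℂ) * Complex.I))
      (v' := fun x => (M₂' x : ℂ)) (fun x _ => hed x) (fun x _ => (h2 x).ofReal_comp)
      (he'c.intervalIntegrable _ _) ((Complex.continuous_ofReal.comp h2c).intervalIntegrable _ _)
    have hI1 : ∫ x in a..c, e x * ((((-κ : ℝ)) : ℂ) * Complex.I) * (M₁ x : ℂ) =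
        ((((-κ : ℝ)) : ℂ) * Complex.I) * ∫ x in a..c, e x * (M₁ x : ℂ) := by
      rw [← intervalIntegral.integral_const_mul]
      apply intervalIntegral.integral_congr; intro x _; ring
    have hI2 : ∫ x in c..b, e x * ((((-κ : ℝ)) : ℂ) * Complex.I) * (M₂ x : ℂ) =
        ((((-κ : ℝ)) : ℂ) * Complex.I) * ∫ x in c..b, e x * (M₂ x : ℂ) := by
      rw [← intervalIntegral.integral_const_mul]
      apply intervalIntegral.integral_congr; intro x _; ring
    -- split the phase integrals at `c`
    have hsQ : ∫ x in a..b, e x * (G' x : ℂ) =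
        (∫ x in a..c, e x * (M₁' x : ℂ)) + ∫ x in c..b, e x * (M₂' x : ℂ) := by
      rw [← intervalIntegral.integral_add_adjacent_intervals (hiQ.mono_set hsub1)
        (hiQ.mono_set hsub2)]
      congr 1
      · exact intervalIntegral.integral_congr fun x hx => by simp only [hG'1 x hx]
      · exact intervalIntegral.integral_congr_ae (Eventually.of_forall fun x hx => by
          simp only [hG'2 x hx])
    have hsP : ∫ x in a..b, e x * (G x : ℂ) =
        (∫ x in a..c, e x * (M₁ x : ℂ)) + ∫ x in c..b, e x * (M₂ x : ℂ) := by
      rw [← intervalIntegral.integral_add_adjacent_intervals (hiP.mono_set hsub1)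
        (hiP.mono_set hsub2)]
      congr 1
      · exact intervalIntegral.integral_congr fun x hx => by simp only [hG1 x hx]
      · exact intervalIntegral.integral_congr fun x hx => by simp only [hG2 x hx]
    -- assemble
    have hmain : ∫ x in a..b, e x * (G' x : ℂ) =
        ((κ : ℝ) : ℂ) * Complex.I * ∫ x in a..b, e x * (G x : ℂ) := by
      rw [hsQ, ibp1, ibp2, hI1, hI2, hsP, heb]
      push_cast
      have hg : (M₁ c : ℂ) = M₂ c := by rw [hglue]
      have ha : (M₂ b : ℂ) = -M₁ a := by rw [hanti]; push_cast; ring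
      rw [hg, ha]
      ring
    rw [hcQ, hcP, hmain, Complex.real_smul, Complex.real_smul]
    push_cast
    ring
  -- termwise comparison of the two Parseval series
  have hterm : ∀ n : ℤ, (π / (b - a)) ^ 2 * ‖fourierCoeffOn hab P n‖ ^ 2 ≤
      ‖fourierCoeffOn hab Q n‖ ^ 2 := by
    intro n
    rw [key n, norm_mul, norm_mul, Complex.norm_I, mul_one, Complex.norm_real, mul_pow,
      Real.norm_eq_abs, sq_abs]
    have hn1 : (1 : ℝ) ≤ |(2 * n + 1 : ℝ)| := by
      have h0 : (2 * n + 1 : ℤ) ≠ 0 := by omega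
      have h1 := Int.one_le_abs h0
      rw [show (2 * n + 1 : ℝ) = ((2 * n + 1 : ℤ) : ℝ) by push_cast; ring, ← Int.cast_abs]
      exact_mod_cast h1
    have h2 : (π / (b - a)) ^ 2 ≤ (π * (2 * n + 1) / (b - a)) ^ 2 := by
      rw [show π * (2 * n + 1) / (b - a) = (π / (b - a)) * (2 * n + 1 : ℝ) by ring, mul_pow,
        ← sq_abs (2 * n + 1 : ℝ)]
      have : (1 : ℝ) ≤ |(2 * n + 1 : ℝ)| ^ 2 := by nlinarith
      have h0 : 0 ≤ (π / (b - a)) ^ 2 := sq_nonneg _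
      nlinarith
    exact mul_le_mul_of_nonneg_right h2 (sq_nonneg _)
  have h := hasSum_le hterm (PP.mul_left ((π / (b - a)) ^ 2)) PQ
  -- rewrite the two integrals
  have hIP : ∫ x in a..b, ‖P x‖ ^ 2 = (∫ x in a..c, M₁ x ^ 2) + ∫ x in c..b, M₂ x ^ 2 := by
    have e1 : ∫ x in a..b, ‖P x‖ ^ 2 = ∫ x in a..b, G x ^ 2 :=
      intervalIntegral.integral_congr fun x _ => hPn x
    have hi : IntervalIntegrable (fun x => G x ^ 2) volume a b :=
      (hGc.pow 2).intervalIntegrable _ _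
    rw [e1, ← intervalIntegral.integral_add_adjacent_intervals (hi.mono_set hsub1)
      (hi.mono_set hsub2)]
    congr 1
    · exact intervalIntegral.integral_congr fun x hx => by simp only [hG1 x hx]
    · exact intervalIntegral.integral_congr fun x hx => by simp only [hG2 x hx]
  have hIQ : ∫ x in a..b, ‖Q x‖ ^ 2 = (∫ x in a..c, M₁' x ^ 2) + ∫ x in c..b, M₂' x ^ 2 := by
    have e1 : ∫ x in a..b, ‖Q x‖ ^ 2 = ∫ x in a..b, G' x ^ 2 :=
      intervalIntegral.integral_congr fun x _ => hQn x
    have hi : IntervalIntegrable (fun x => G' x ^ 2) volume a b := by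
      refine intervalIntegrable_Ioc_of_bound hab.le ?_ ((max C₁ C₂) ^ 2) fun x hx => ?_
      · exact (hG'm.pow_const 2).aestronglyMeasurable
      · rw [Real.norm_eq_abs, abs_pow, sq_abs]
        have h0 : 0 ≤ ‖G' x‖ := norm_nonneg _
        have h1 := hG'b x hx
        rw [show G' x ^ 2 = ‖G' x‖ ^ 2 by rw [Real.norm_eq_abs, sq_abs]]
        exact pow_le_pow_left₀ h0 h1 2
    rw [e1, ← intervalIntegral.integral_add_adjacent_intervals (hi.mono_set hsub1)
      (hi.mono_set hsub2)]
    congr 1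
    · exact intervalIntegral.integral_congr fun x hx => by simp only [hG'1 x hx]
    · exact intervalIntegral.integral_congr_ae (Eventually.of_forall fun x hx => by
        simp only [hG'2 x hx])
  rw [hIP] at h; rw [hIQ] at h
  -- `h : (π/T)² (T⁻¹ A) ≤ T⁻¹ B`; multiply by `T`
  have := mul_le_mul_of_nonneg_left h hT.le
  calc (π / (b - a)) ^ 2 * ((∫ x in a..c, M₁ x ^ 2) + ∫ x in c..b, M₂ x ^ 2)
      = (b - a) * ((π / (b - a)) ^ 2 *
          ((b - a)⁻¹ * ((∫ x in a..c, M₁ x ^ 2) + ∫ x in c..b, M₂ x ^ 2))) := by field_simp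
    _ ≤ (b - a) * ((b - a)⁻¹ * ((∫ x in a..c, M₁' x ^ 2) + ∫ x in c..b, M₂' x ^ 2)) := this
    _ = _ := by field_simp


/-- **Antiperiodic Wirtinger inequality.** For a `C¹` function `M` with `M b = −M a` (`a < b`, `T =
b − a`): `(π/T)² ∫_a^b M² ≤ ∫_a^b M′²` (the engine with both pieces equal to `M`). (Private proof
engine of `CroceDacorognaWirtinger_holds`: a classical Wirtinger-type inequality, kept private
because this file exports only the cited printed statements.) [folklore] -/
private theorem antiperiodic_wirtinger {M M' : ℝ → ℝ} {a b : ℝ} (hab : a < b)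
    (hM : ∀ x, HasDerivAt M (M' x) x) (hM'c : Continuous M') (hanti : M b = -M a) :
    (π / (b - a)) ^ 2 * ∫ x in a..b, M x ^ 2 ≤ ∫ x in a..b, M' x ^ 2 := by
  have hMc : Continuous M := continuous_iff_continuousAt.mpr fun x => (hM x).continuousAt
  have hac : a < (a + b) / 2 := by linarith
  have hcb : (a + b) / 2 < b := by linarith
  have h := antiperiodic_wirtinger_two_piece hac hcb hM hM'c hM hM'c rfl hanti
  have hi : IntervalIntegrable (fun x => M x ^ 2) volume a ((a + b) / 2) ∧
      IntervalIntegrable (fun x => M x ^ 2) volume ((a + b) / 2) b :=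
    ⟨(hMc.pow 2).intervalIntegrable _ _, (hMc.pow 2).intervalIntegrable _ _⟩
  have hi' : IntervalIntegrable (fun x => M' x ^ 2) volume a ((a + b) / 2) ∧
      IntervalIntegrable (fun x => M' x ^ 2) volume ((a + b) / 2) b :=
    ⟨(hM'c.pow 2).intervalIntegrable _ _, (hM'c.pow 2).intervalIntegrable _ _⟩
  have s1 : (∫ x in a..(a + b) / 2, M x ^ 2) + ∫ x in (a + b) / 2..b, M x ^ 2 =
      ∫ x in a..b, M x ^ 2 := intervalIntegral.integral_add_adjacent_intervals hi.1 hi.2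
  have s2 : (∫ x in a..(a + b) / 2, M' x ^ 2) + ∫ x in (a + b) / 2..b, M' x ^ 2 =
      ∫ x in a..b, M' x ^ 2 := intervalIntegral.integral_add_adjacent_intervals hi'.1 hi'.2
  rwa [s1, s2] at h

/-- **Wirtinger inequality for a periodic function with a zero.** For a `C¹` function `E` with `E a
= E b` (`a < b`, `T = b − a`) vanishing at some point of `[a, b]`: `(π/T)² ∫_a^b E² ≤ ∫_a^b E′²`
(rotate the period to start at the zero: the engine with the pieces `E` on `[y₀, b]` and `E(· − T)`
on `[b, y₀ + T]`, which vanish at both ends). (Private proof engine of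
`CroceDacorognaWirtinger_holds`: a classical Wirtinger-type inequality, kept private because this
file exports only the cited printed statements.) [folklore] -/
private theorem periodic_wirtinger_of_zero {E E' : ℝ → ℝ} {a b : ℝ} (hab : a < b)
    (hE : ∀ x, HasDerivAt E (E' x) x) (hE'c : Continuous E') (hper : E a = E b) {y₀ : ℝ}
    (hy₀ : y₀ ∈ Icc a b) (hz : E y₀ = 0) :
    (π / (b - a)) ^ 2 * ∫ x in a..b, E x ^ 2 ≤ ∫ x in a..b, E' x ^ 2 := by
  have hEc : Continuous E := continuous_iff_continuousAt.mpr fun x => (hE x).continuousAt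
  -- the endpoint cases: `E a = E b = 0`, antiperiodic Wirtinger directly
  by_cases hend : y₀ = a ∨ y₀ = b
  · have ha0 : E a = 0 := by
      rcases hend with h | h
      · rw [← h, hz]
      · rw [hper, ← h, hz]
    have hb0 : E b = 0 := by rw [← hper, ha0]
    exact antiperiodic_wirtinger hab hE hE'c (by rw [hb0, ha0, neg_zero])
  push Not at hend
  have hay : a < y₀ := lt_of_le_of_ne hy₀.1 (Ne.symm hend.1)
  have hyb : y₀ < b := lt_of_le_of_ne hy₀.2 hend.2
  -- the rotated pieces
  have hE2 : ∀ x, HasDerivAt (fun x => E (x - (b - a))) (E' (x - (b - a))) x := fun x =>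
    (hE (x - (b - a))).comp_sub_const x (b - a)
  have hE2c : Continuous fun x => E' (x - (b - a)) := hE'c.comp (by fun_prop)
  have hcb : b < y₀ + (b - a) := by linarith
  have h := antiperiodic_wirtinger_two_piece (M₁ := E) (M₂ := fun x => E (x - (b - a))) hyb hcb
    hE hE'c hE2 hE2c (by show E b = E (b - (b - a)); rw [show b - (b - a) = a by ring, hper])
    (by show E (y₀ + (b - a) - (b - a)) = -E y₀; rw [show y₀ + (b - a) - (b - a) = y₀ by ring, hz,
      neg_zero])
  have hT : y₀ + (b - a) - y₀ = b - a := by ring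
  rw [hT] at h
  have e1 : ∫ x in b..y₀ + (b - a), E (x - (b - a)) ^ 2 = ∫ x in a..y₀, E x ^ 2 := by
    rw [intervalIntegral.integral_comp_sub_right (fun x => E x ^ 2) (b - a)]
    congr 1 <;> ring
  have e2 : ∫ x in b..y₀ + (b - a), E' (x - (b - a)) ^ 2 = ∫ x in a..y₀, E' x ^ 2 := by
    rw [intervalIntegral.integral_comp_sub_right (fun x => E' x ^ 2) (b - a)]
    congr 1 <;> ring
  rw [e1, e2] at h
  have s1 : (∫ x in y₀..b, E x ^ 2) + ∫ x in a..y₀, E x ^ 2 = ∫ x in a..b, E x ^ 2 := by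
    rw [add_comm]
    exact intervalIntegral.integral_add_adjacent_intervals ((hEc.pow 2).intervalIntegrable _ _)
      ((hEc.pow 2).intervalIntegrable _ _)
  have s2 : (∫ x in y₀..b, E' x ^ 2) + ∫ x in a..y₀, E' x ^ 2 = ∫ x in a..b, E' x ^ 2 := by
    rw [add_comm]
    exact intervalIntegral.integral_add_adjacent_intervals ((hE'c.pow 2).intervalIntegrable _ _)
      ((hE'c.pow 2).intervalIntegrable _ _)
  rwa [s1, s2] at h

/-- **Wirtinger's inequality with constant `π²` on `(−1, 1)` under an antipodal zero.** For a `C¹`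
function `u` with `u(−1) = u(1)` such that `u(y₀) + u(y₀ + 1) = 0` for some `y₀ ∈ [−1, 0]`: `π²
∫_{−1}^{1} u² ≤ ∫_{−1}^{1} u′²`. Proof: the half-shift decomposition `u = E + M`, `u(· + 1) = E − M`
on `[−1, 0]` with `E = (u + u(·+1))/2` (`E(−1) = E(0)`, zero at `y₀`) and `M = (u − u(·+1))/2`
(`M(0) = −M(−1)`); `∫_{−1}^{1} u² = 2∫_{−1}^{0}(E² + M²)` and the same for `u′`;
`periodic_wirtinger_of_zero` for `E` and `antiperiodic_wirtinger` for `M` on `[−1, 0]` (period `1`,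
constant `π²`). (Private proof engine of `CroceDacorognaWirtinger_holds`: a classical Wirtinger-type
inequality, kept private because this file exports only the cited printed statements.) [folklore] -/
private theorem wirtinger_of_antipodal_zero {u u' : ℝ → ℝ} (hu : ∀ y, HasDerivAt u (u' y) y)
    (hu'c : Continuous u') (hper : u (-1) = u 1) {y₀ : ℝ} (hy₀ : y₀ ∈ Icc (-1 : ℝ) 0)
    (hz : u y₀ + u (y₀ + 1) = 0) :
    π ^ 2 * ∫ y in (-1 : ℝ)..1, u y ^ 2 ≤ ∫ y in (-1 : ℝ)..1, u' y ^ 2 := by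
  have huc : Continuous u := continuous_iff_continuousAt.mpr fun x => (hu x).continuousAt
  have hu1 : ∀ y, HasDerivAt (fun y => u (y + 1)) (u' (y + 1)) y := fun y =>
    (hu (y + 1)).comp_add_const y 1
  -- the half-shift decomposition
  have hE : ∀ y, HasDerivAt (fun y => (u y + u (y + 1)) / 2) ((u' y + u' (y + 1)) / 2) y :=
    fun y => ((hu y).add (hu1 y)).div_const 2
  have hM : ∀ y, HasDerivAt (fun y => (u y - u (y + 1)) / 2) ((u' y - u' (y + 1)) / 2) y :=
    fun y => ((hu y).sub (hu1 y)).div_const 2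
  have hE'c : Continuous fun y => (u' y + u' (y + 1)) / 2 := by fun_prop
  have hM'c : Continuous fun y => (u' y - u' (y + 1)) / 2 := by fun_prop
  have h10 : (-1 : ℝ) < 0 := by norm_num
  have e10 : (-1 : ℝ) + 1 = 0 := by norm_num
  have e01 : (0 : ℝ) + 1 = 1 := by norm_num
  have hB := periodic_wirtinger_of_zero h10 hE hE'c
    (by show (u (-1) + u (-1 + 1)) / 2 = (u 0 + u (0 + 1)) / 2; rw [hper, e10, e01]; ring) hy₀
    (by show (u y₀ + u (y₀ + 1)) / 2 = 0; rw [hz, zero_div])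
  have hA := antiperiodic_wirtinger h10 hM hM'c
    (by show (u 0 - u (0 + 1)) / 2 = -((u (-1) - u (-1 + 1)) / 2); rw [hper, e10, e01]; ring)
  have hπ : (π / (0 - (-1)) : ℝ) ^ 2 = π ^ 2 := by norm_num
  rw [hπ] at hA hB
  -- `∫_{-1}^{1} f = ∫_{-1}^{0} (f + f(·+1))` for `f = u², u'²`
  have split : ∀ f : ℝ → ℝ, Continuous f →
      ∫ y in (-1 : ℝ)..1, f y = ∫ y in (-1 : ℝ)..0, (f y + f (y + 1)) := by
    intro f hf
    have hf1 : Continuous fun y => f (y + 1) := by fun_prop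
    rw [intervalIntegral.integral_add (hf.intervalIntegrable _ _) (hf1.intervalIntegrable _ _),
      intervalIntegral.integral_comp_add_right f 1]
    norm_num
    exact (intervalIntegral.integral_add_adjacent_intervals (hf.intervalIntegrable _ _)
      (hf.intervalIntegrable _ _)).symm
  have dec : ∀ p q : ℝ, p ^ 2 + q ^ 2 = 2 * (((p + q) / 2) ^ 2 + ((p - q) / 2) ^ 2) := by
    intro p q; ring
  have hU : ∫ y in (-1 : ℝ)..1, u y ^ 2 = 2 * ((∫ y in (-1 : ℝ)..0, ((u y + u (y + 1)) / 2) ^ 2) +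
      ∫ y in (-1 : ℝ)..0, ((u y - u (y + 1)) / 2) ^ 2) := by
    rw [split (fun y => u y ^ 2) (huc.pow 2), ← intervalIntegral.integral_add
      ((by fun_prop : Continuous fun y => ((u y + u (y + 1)) / 2) ^ 2).intervalIntegrable _ _)
      ((by fun_prop : Continuous fun y => ((u y - u (y + 1)) / 2) ^ 2).intervalIntegrable _ _),
      ← intervalIntegral.integral_const_mul]
    exact intervalIntegral.integral_congr fun y _ => dec _ _
  have hU' : ∫ y in (-1 : ℝ)..1, u' y ^ 2 =
      2 * ((∫ y in (-1 : ℝ)..0, ((u' y + u' (y + 1)) / 2) ^ 2) +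
      ∫ y in (-1 : ℝ)..0, ((u' y - u' (y + 1)) / 2) ^ 2) := by
    rw [split (fun y => u' y ^ 2) (hu'c.pow 2), ← intervalIntegral.integral_add
      ((by fun_prop : Continuous fun y => ((u' y + u' (y + 1)) / 2) ^ 2).intervalIntegrable _ _)
      ((by fun_prop : Continuous fun y => ((u' y - u' (y + 1)) / 2) ^ 2).intervalIntegrable _ _),
      ← intervalIntegral.integral_const_mul]
    exact intervalIntegral.integral_congr fun y _ => dec _ _
  rw [hU, hU']
  linarith

/-- `t ↦ |t|^p · t` (`= sign(t)|t|^{p+1}`) is strictly increasing for `p > −1`. (Private proof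
device of `CroceDacorognaWirtinger_holds`; not itself a printed statement.) [folklore] -/
private theorem strictMono_abs_rpow_mul_self {p : ℝ} (hp : -1 < p) :
    StrictMono fun t : ℝ => |t| ^ p * t := by
  have hp1 : 0 < p + 1 := by linarith
  have mono_nonneg : ∀ a b : ℝ, 0 ≤ a → a < b → |a| ^ p * a < |b| ^ p * b := by
    intro a b ha hab
    have hb : 0 < b := by linarith
    have eb : |b| ^ p * b = b ^ (p + 1) := by
      rw [abs_of_pos hb, Real.rpow_add_one hb.ne' p]
    rcases ha.eq_or_lt with h | h
    · rw [← h, mul_zero, eb]; exact Real.rpow_pos_of_pos hb _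
    · have ea : |a| ^ p * a = a ^ (p + 1) := by
        rw [abs_of_pos h, Real.rpow_add_one h.ne' p]
      rw [ea, eb]; exact Real.rpow_lt_rpow ha hab hp1
  intro a b hab
  dsimp only
  rcases le_or_gt 0 a with ha | ha
  · exact mono_nonneg a b ha hab
  · rcases le_or_gt b 0 with hb | hb
    · have h := mono_nonneg (-b) (-a) (by linarith) (by linarith)
      rw [abs_neg, abs_neg] at h
      linarith
    · have h1 : |a| ^ p * a < 0 :=
        mul_neg_of_pos_of_neg (Real.rpow_pos_of_pos (abs_pos.2 ha.ne) _) ha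
      have h2 : 0 < |b| ^ p * b := mul_pos (Real.rpow_pos_of_pos (abs_pos.2 hb.ne') _) hb
      linarith

/-- `t ↦ |t|^p · t` is continuous for `p > −1` (at `0`: `‖|t|^p t‖ = |t|^{p+1} → 0`). (Private proof
device of `CroceDacorognaWirtinger_holds`; not itself a printed statement.) [folklore] -/
private theorem continuous_abs_rpow_mul_self {p : ℝ} (hp : -1 < p) :
    Continuous fun t : ℝ => |t| ^ p * t := by
  have hp1 : 0 < p + 1 := by linarith
  have hg : Continuous fun t : ℝ => |t| ^ (p + 1) :=
    continuous_abs.rpow_const fun _ => Or.inr hp1.le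
  have hbound : ∀ t : ℝ, ‖|t| ^ p * t‖ ≤ |t| ^ (p + 1) := by
    intro t
    by_cases ht : t = 0
    · rw [ht, mul_zero, norm_zero]; exact Real.rpow_nonneg (abs_nonneg _) _
    · rw [Real.norm_eq_abs, abs_mul, abs_of_nonneg (Real.rpow_nonneg (abs_nonneg t) p),
        Real.rpow_add_one (abs_ne_zero.2 ht)]
  refine continuous_iff_continuousAt.2 fun t => ?_
  by_cases ht : t = 0
  · subst ht
    rw [ContinuousAt, mul_zero]
    refine squeeze_zero_norm hbound ?_
    have := hg.tendsto 0
    rwa [abs_zero, Real.zero_rpow hp1.ne'] at this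
  · exact (continuous_abs.continuousAt.rpow_const (Or.inl (abs_ne_zero.2 ht))).mul
      continuousAt_id

/-- **The constraint forces an antipodal zero.** If `φ` is odd, strictly increasing and continuous,
`u` is continuous and `∫_{−1}^{1} φ(u) = 0`, then `u(y₀) + u(y₀ + 1) = 0` for some `y₀ ∈ [−1, 0]`:
otherwise `u + u(·+1)` has a sign on `[−1, 0]`, hence so has `φ(u) + φ(u(·+1))` pointwise (`φ` odd
increasing), contradicting `∫_{−1}^{0} [φ(u) + φ(u(·+1))] = ∫_{−1}^{1} φ(u) = 0`. (Private proof
device of `CroceDacorognaWirtinger_holds`; the generality is the proof's, not the paper's; not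
itself a printed statement.) [folklore] -/
private theorem exists_antipodal_zero_of_integral_comp_eq_zero (φ : ℝ → ℝ)
    (hφo : ∀ t, φ (-t) = -φ t)
    (hφm : StrictMono φ) (hφc : Continuous φ) {u : ℝ → ℝ} (huc : Continuous u)
    (h0 : ∫ y in (-1 : ℝ)..1, φ (u y) = 0) :
    ∃ y₀ ∈ Icc (-1 : ℝ) 0, u y₀ + u (y₀ + 1) = 0 := by
  -- the positive case, for a general continuous `v` with `∫ φ(v) = 0`
  have pos_case : ∀ v : ℝ → ℝ, Continuous v → (∫ y in (-1 : ℝ)..1, φ (v y)) = 0 →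
      (∀ y ∈ Icc (-1 : ℝ) 0, 0 < v y + v (y + 1)) → False := by
    intro v hvc hv0 hpos
    have hφv : Continuous fun y => φ (v y) := hφc.comp hvc
    have hφv1 : Continuous fun y => φ (v (y + 1)) := by fun_prop
    have hsplit : ∫ y in (-1 : ℝ)..1, φ (v y) = ∫ y in (-1 : ℝ)..0, (φ (v y) + φ (v (y + 1))) := by
      rw [intervalIntegral.integral_add (hφv.intervalIntegrable _ _) (hφv1.intervalIntegrable _ _),
        intervalIntegral.integral_comp_add_right (fun y => φ (v y)) 1]
      norm_num
      exact (intervalIntegral.integral_add_adjacent_intervals (hφv.intervalIntegrable _ _)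
        (hφv.intervalIntegrable _ _)).symm
    have hlt : 0 < ∫ y in (-1 : ℝ)..0, (φ (v y) + φ (v (y + 1))) := by
      refine intervalIntegral.intervalIntegral_pos_of_pos_on
        ((hφv.add hφv1).intervalIntegrable _ _) ?_ (by norm_num)
      intro y hy
      have h1 : -v (y + 1) < v y := by linarith [hpos y (Ioo_subset_Icc_self hy)]
      have h2 := hφm h1
      rw [hφo] at h2
      linarith
    rw [← hsplit, hv0] at hlt
    exact lt_irrefl _ hlt
  by_contra H
  push Not at H
  -- `S = u + u(·+1)` has no zero on `[-1, 0]`, hence a sign (intermediate value theorem)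
  have hSc : Continuous fun y => u y + u (y + 1) := by fun_prop
  rcases lt_or_gt_of_ne (H (-1) (by norm_num)) with hneg | hpos
  · -- negative at `-1` ⇒ negative everywhere ⇒ apply the positive case to `-u`
    refine pos_case (fun y => -u y) huc.neg
      (by simp only [hφo, intervalIntegral.integral_neg, h0, neg_zero]) ?_
    intro y hy
    rcases lt_or_gt_of_ne (H y hy) with h | h
    · linarith
    · exfalso
      have hivt := intermediate_value_Icc (f := fun y => u y + u (y + 1)) hy.1 hSc.continuousOn
      have h0mem : (0 : ℝ) ∈ Icc (u (-1) + u (-1 + 1)) (u y + u (y + 1)) := ⟨hneg.le, h.le⟩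
      obtain ⟨z, hz, hz0⟩ := hivt h0mem
      exact H z ⟨hz.1, hz.2.trans hy.2⟩ hz0
  · refine pos_case u huc h0 ?_
    intro y hy
    rcases lt_or_gt_of_ne (H y hy) with h | h
    · exfalso
      have hivt := intermediate_value_Icc' (f := fun y => u y + u (y + 1)) hy.1 hSc.continuousOn
      have h0mem : (0 : ℝ) ∈ Icc (u y + u (y + 1)) (u (-1) + u (-1 + 1)) := ⟨h.le, hpos.le⟩
      obtain ⟨z, hz, hz0⟩ := hivt h0mem
      exact H z ⟨hz.1, hz.2.trans hy.2⟩ hz0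
    · exact h

/-- **Generalized Wirtinger inequality with an odd increasing constraint** (`p = q = 2`). For `φ`
odd, strictly increasing and continuous, and a `C¹` function `u` with `u(−1) = u(1)` and `∫_{−1}^{1}
φ(u) = 0`: `π² ∫_{−1}^{1} u² ≤ ∫_{−1}^{1} u′²` (equality for `u = A cos(πy + c)`). This is
`exists_antipodal_zero_of_integral_comp_eq_zero` + `wirtinger_of_antipodal_zero`; it contains
Croce–Dacorogna 2003 Thm 1.1 at `p = q = 2` (`φ(t) = |t|^{r−2}t`) — by a different, elementary proof
(the published proof is variational: existence of minimizers and an analysis of the Euler–Lagrange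
equation). (Private proof device of `CroceDacorognaWirtinger_holds`; the generality is the proof's,
not the paper's; not itself a printed statement.) [folklore] -/
private theorem sq_integral_le_of_integral_odd_comp_eq_zero (φ : ℝ → ℝ) (hφo : ∀ t, φ (-t) = -φ t)
    (hφm : StrictMono φ) (hφc : Continuous φ) {u u' : ℝ → ℝ} (hu : ∀ y, HasDerivAt u (u' y) y)
    (hu'c : Continuous u') (hper : u (-1) = u 1) (h0 : ∫ y in (-1 : ℝ)..1, φ (u y) = 0) :
    π ^ 2 * ∫ y in (-1 : ℝ)..1, u y ^ 2 ≤ ∫ y in (-1 : ℝ)..1, u' y ^ 2 := by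
  have huc : Continuous u := continuous_iff_continuousAt.mpr fun x => (hu x).continuousAt
  obtain ⟨y₀, hy₀, hz⟩ := exists_antipodal_zero_of_integral_comp_eq_zero φ hφo hφm hφc huc h0
  exact wirtinger_of_antipodal_zero hu hu'c hper hy₀ hz

/-! ### Croce–Dacorogna 2003, Theorem 1.1 at `p = q = 2` — the printed statement, and its proof -/

/-- **Croce–Dacorogna 2003, Theorem 1.1 with `p = q = 2`, and Remark 1.2 (ii) (`α(2,2,2) = π`) —
`C¹` form, AS PRINTED on the period interval `(−1,1)`**: for every real `r` with `2 ≤ r ≤ 3` and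
every `C¹` function `u : ℝ → ℝ` with `u(−1) = u(1)` and `∫_{−1}^{1}|u|^{r−2}·u = 0`:
`π²∫_{−1}^{1}u² ≤ ∫_{−1}^{1}u′²` (`‖u′‖₂ ≥ α(2,2,r)‖u‖₂`, `α(2,2,r) = α(2,2,2) = π`: the printed
hypotheses `p > 1`, `q ≥ r − 1 ≥ 1`, `q ≤ rp + r − 1` read `2 ≤ r ≤ 3` at `p = q = 2`; the printed
class is `W^{1,2}_per(−1,1) = {u ∈ W^{1,2}(−1,1) : u(−1) = u(1)}`, of which the `C¹` functions
with `u(−1) = u(1)` are a sub-class). Kept as a named `Prop` because downstream files take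
exactly this statement as a hypothesis; it is PROVED below (`CroceDacorognaWirtinger_holds`).
[cite: CroceDacorogna2003, Thm 1.1 and Rem. 1.2 (ii)] -/
def CroceDacorognaWirtinger : Prop :=
  ∀ r : ℝ, 2 ≤ r → r ≤ 3 → ∀ (u u' : ℝ → ℝ), (∀ y, HasDerivAt u (u' y) y) → Continuous u' →
    u (-1) = u 1 → ∫ y in (-1 : ℝ)..1, |u y| ^ (r - 2) * u y = 0 →
      π ^ 2 * ∫ y in (-1 : ℝ)..1, u y ^ 2 ≤ ∫ y in (-1 : ℝ)..1, u' y ^ 2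

/-- **Croce–Dacorogna 2003, Theorem 1.1 at `p = q = 2` holds** (all `2 ≤ r ≤ 3`; the proof uses
only `r > 1`): `φ(t) = |t|^{r−2}t` is odd, strictly increasing and continuous, so
`sq_integral_le_of_integral_odd_comp_eq_zero` applies. [cite: CroceDacorogna2003, Thm 1.1] -/
theorem CroceDacorognaWirtinger_holds : CroceDacorognaWirtinger := by
  intro r hr2 _hr3 u u' hu hu'c hper h0
  have hp : -1 < r - 2 := by linarith
  exact sq_integral_le_of_integral_odd_comp_eq_zero (fun t => |t| ^ (r - 2) * t)
    (fun t => by simp only [abs_neg]; ring) (strictMono_abs_rpow_mul_self hp)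
    (continuous_abs_rpow_mul_self hp) hu hu'c hper h0

/-- The `r = 2` slice, for the record: the constraint is `∫_{−1}^{1} u = 0` and the statement is
the classical Wirtinger inequality with period `2` (tree `wirtinger_interval_real`); this is
the printed Remark 1.2 (ii) (`p = q = r = 2`, `α(2,2,2) = π`).
[cite: CroceDacorogna2003, Rem. 1.2 (ii)] -/
theorem croceDacorognaWirtinger_two (u u' : ℝ → ℝ) (hd : ∀ y, HasDerivAt u (u' y) y)
    (hc : Continuous u') (hp : u (-1) = u 1) (h0 : ∫ y in (-1 : ℝ)..1, u y = 0) :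
    π ^ 2 * ∫ y in (-1 : ℝ)..1, u y ^ 2 ≤ ∫ y in (-1 : ℝ)..1, u' y ^ 2 := by
  have h := wirtinger_interval_real (a := (-1 : ℝ)) (b := 1) (by norm_num) hd hc hp.symm h0
  have e2 : (2 * π / (1 - (-1)) : ℝ) ^ 2 = π ^ 2 := by ring
  rwa [e2] at h

/-- **Rescaled form on an interval** (`p = q = 2`): for `a < b`, `φ` odd, strictly increasing and
continuous, and a `C¹` function `u` with `u a = u b` and `∫_a^b φ(u) = 0`: `(2π/(b−a))² ∫_a^b u² ≤
∫_a^b u′²` (the affine change of variables `x = (a+b)/2 + (b−a)/2·y`; Croce–Dacorogna Rem. 1.2 (i):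
`α_{a,b}(2,2,r) = (2/(b−a))·π`). (Private proof device of `CroceDacorognaWirtinger_holds`; the
generality is the proof's, not the paper's; not itself a printed statement.) [folklore] -/
private theorem sq_integral_le_of_integral_odd_comp_eq_zero_interval (φ : ℝ → ℝ)
    (hφo : ∀ t, φ (-t) = -φ t) (hφm : StrictMono φ) (hφc : Continuous φ) {u u' : ℝ → ℝ}
    {a b : ℝ} (hab : a < b) (hu : ∀ x, HasDerivAt u (u' x) x) (hu'c : Continuous u')
    (hper : u a = u b) (h0 : ∫ x in a..b, φ (u x) = 0) :
    (2 * π / (b - a)) ^ 2 * ∫ x in a..b, u x ^ 2 ≤ ∫ x in a..b, u' x ^ 2 := by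
  set h : ℝ := (b - a) / 2 with hh
  set m : ℝ := (a + b) / 2 with hm
  have hpos : 0 < h := by rw [hh]; linarith
  have hne : h ≠ 0 := hpos.ne'
  have hlo : h * (-1) + m = a := by rw [hh, hm]; ring
  have hhi : h * 1 + m = b := by rw [hh, hm]; ring
  -- the rescaled function `v(y) = u(h y + m)`
  have hin : ∀ y : ℝ, HasDerivAt (fun y : ℝ => h * y + m) h y := fun y => by
    simpa using ((hasDerivAt_id y).const_mul h).add_const m
  have hv : ∀ y, HasDerivAt (fun y => u (h * y + m)) (h * u' (h * y + m)) y := fun y =>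
    ((hu (h * y + m)).comp y (hin y)).congr_deriv (by ring)
  have hv'c : Continuous fun y => h * u' (h * y + m) := by fun_prop
  have hvper : (fun y => u (h * y + m)) (-1) = (fun y => u (h * y + m)) 1 := by
    show u (h * (-1) + m) = u (h * 1 + m); rw [hlo, hhi, hper]
  have resc : ∀ f : ℝ → ℝ, ∫ y in (-1 : ℝ)..1, f (h * y + m) = h⁻¹ * ∫ x in a..b, f x := by
    intro f
    rw [intervalIntegral.integral_comp_mul_add f hne m, hlo, hhi, smul_eq_mul]
  have hv0 : ∫ y in (-1 : ℝ)..1, φ (u (h * y + m)) = 0 := by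
    rw [resc (fun x => φ (u x)), h0, mul_zero]
  have key := sq_integral_le_of_integral_odd_comp_eq_zero φ hφo hφm hφc hv hv'c hvper hv0
  rw [resc (fun x => u x ^ 2)] at key
  have e2 : ∫ y in (-1 : ℝ)..1, (h * u' (h * y + m)) ^ 2 =
      h⁻¹ * (h ^ 2 * ∫ x in a..b, u' x ^ 2) := by
    rw [← intervalIntegral.integral_const_mul, ← resc (fun x => h ^ 2 * u' x ^ 2)]
    exact intervalIntegral.integral_congr fun y _ => by ring
  rw [e2] at key
  -- `key : π² (h⁻¹ A) ≤ h⁻¹ (h² B)`; conclude `(π/h)² A ≤ B`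
  have eπ : (2 * π / (b - a)) = π / h := by rw [hh]; field_simp
  rw [eπ]
  have := mul_le_mul_of_nonneg_left key hpos.le
  have k2 : π ^ 2 * (∫ x in a..b, u x ^ 2) ≤ h ^ 2 * ∫ x in a..b, u' x ^ 2 := by
    have e1 : h * (π ^ 2 * (h⁻¹ * ∫ x in a..b, u x ^ 2)) = π ^ 2 * ∫ x in a..b, u x ^ 2 := by
      field_simp
    have e3 : h * (h⁻¹ * (h ^ 2 * ∫ x in a..b, u' x ^ 2)) = h ^ 2 * ∫ x in a..b, u' x ^ 2 := by
      field_simp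
    rwa [e1, e3] at this
  have h2 : 0 < h ^ 2 := by positivity
  calc (π / h) ^ 2 * ∫ x in a..b, u x ^ 2
      = (π ^ 2 * ∫ x in a..b, u x ^ 2) / h ^ 2 := by rw [div_pow]; ring
    _ ≤ (h ^ 2 * ∫ x in a..b, u' x ^ 2) / h ^ 2 := div_le_div_of_nonneg_right k2 h2.le
    _ = _ := by field_simp

/-- **Croce–Dacorogna on an interval** (`p = q = 2`; Thm 1.1 with Rem. 1.2 (i), whose rescaling
factor `(2/(b−a))^{1/p′+1/q}` is `2/(b−a)` at `p = q = 2`), AS PRINTED: for `2 ≤ r ≤ 3`, `a < b`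
and a `C¹` function `u` with `u a = u b` and `∫_a^b |u|^{r−2}u = 0`:
`(2π/(b−a))² ∫_a^b u² ≤ ∫_a^b u′²` (e.g. on `(0,1)`: `4π² ∫₀¹ u² ≤ ∫₀¹ u′²`). (The proof device
works for every `r > 1`; that extension is not a printed statement and is not exported here.)
[cite: CroceDacorogna2003, Thm 1.1 and Rem. 1.2 (i)] -/
theorem croceDacorognaWirtinger_interval {r : ℝ} (hr2 : 2 ≤ r) (_hr3 : r ≤ 3) {u u' : ℝ → ℝ}
    {a b : ℝ} (hab : a < b) (hu : ∀ x, HasDerivAt u (u' x) x) (hu'c : Continuous u')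
    (hper : u a = u b) (h0 : ∫ x in a..b, |u x| ^ (r - 2) * u x = 0) :
    (2 * π / (b - a)) ^ 2 * ∫ x in a..b, u x ^ 2 ≤ ∫ x in a..b, u' x ^ 2 := by
  have hp : -1 < r - 2 := by linarith
  exact sq_integral_le_of_integral_odd_comp_eq_zero_interval (fun t => |t| ^ (r - 2) * t)
    (fun t => by simp only [abs_neg]; ring) (strictMono_abs_rpow_mul_self hp)
    (continuous_abs_rpow_mul_self hp) hab hu hu'c hper h0

end Literature.Analysis.FluidPDE
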